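import Mathlib.CategoryTheory.Widesubcategory
import Mathlib.CategoryTheory.Comma.Over.Basic
import Mathlib.Algebra.Group.PUnit
import Mathlib.CategoryTheory.Functor.Const
import Literature.AlgebraicGeometry.Frobenioids.PreFrobenioidMorphisms
import Literature.AlgebraicGeometry.Frobenioids.ModelFrobenioidFunctor
import Literature.AlgebraicGeometry.Frobenioids.ArchimedeanDivisors
import HarnessLib

/-!
# Frobenioids II, Example 3.3 (iii)(iv): the angular Frobenioid `A₀` and the angloids `N₀`, `R₀`

Mochizuki, *The geometry of Frobenioids II: poly-Frobenioids*, Kyushu J. Math. **62** (2008)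
401–460, §3, Example 3.3 (iii), (iv), author's text pp. 28–29
[cite: MochizukiFrdII2008, Ex 3.3 (iii)(iv) pp.28-29] — the ABSOLUTE versions (over `D₀`):

* (iii) "Write `A₀ ⊆ C₀` … for the respective subcategories determined by the *isometries* …
  Write `N₀ := A₀^lin ⊆ A₀` [i.e., the respective subcategories determined by the *linear
  morphisms*] … a *non-rigidified angloid*";
* (iv) "Observe that all real objects of `N₀` are isomorphic. Thus, it makes sense to define
  `R₀ := (N₀)_A` … for `A ∈ Ob(N₀[ℝ])` … a *rigidified angloid*".

**Rendering.** Subcategories "determined by" a class of arrows are Mathlib `WideSubcategory`s of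
the corresponding `MorphismProperty` of found's pre-Frobenioid vocabulary (`PreFrobenioid.IsIsometry`,
`PreFrobenioid.linearMorphisms`, [FrdI] Def. 1.2); `(N₀)_A` is the slice `Over A` ([FrdI] §0,
`C_A`), taken at the real object `N0.realUnit` of tip `1` (any other choice is isomorphic, by (iv),
PROVED here: `N0.nonempty_iso_of_isRealObj`).

**Contents / claims.** Generic: `PreFrobenioid.isometricMorphisms F` with its multiplicativity
(isometries contain identities and compose — `Div(ψ ≫ φ) = Base(ψ)^*Div(φ) · Div(ψ)^{d}`), and the
multiplicativity of found's `linearMorphisms F`; the isometry structure over t2's zero monoid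
`zeroMonoid D` (`ModelFrobenioidFunctor.lean`); `A0`, `N0`, `R0` with their inclusion / structure
functors; "all real objects of `N₀` are isomorphic" PROVED. Deliberately NOT here: the RELATIVE
categories `C = C₀ ×_{D₀} D`, `A`, `N`, `R`, items (ii), (v) and Remark 3.3.1 (they need found's
`FiberProducts.lean` and `Frobenioid.lean`; file `AngularFrobenioidsRelative.lean`).
-/

namespace Literature.AlgebraicGeometry.Frobenioids

open CategoryTheory Opposite
open scoped Pointwise NNReal

noncomputable section

universe w v v' u u'

/-! ### Generic: the wide subcategories of isometries and of linear morphisms -/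

namespace PreFrobenioid

variable {D : Type u} [Category.{v} D] {Φ : Dᵒᵖ ⥤ CommMonCat.{w}}
  {C : Type u'} [Category.{v'} C] (F : C ⥤ ElemFrobenioid Φ)

/-- The class of isometries `Div(φ) = 0` of a pre-Frobenioid ([FrdI] Def. 1.2 (i); [FrdII] Ex. 3.3
(iii) "the subcategories determined by the isometries"). [cite: MochizukiFrdII2008, Ex 3.3 (iii) p.28] -/
def isometricMorphisms : MorphismProperty C := fun _ _ φ => IsIsometry F φ

/-- Membership in the class of isometries. [cite: MochizukiFrdII2008, Ex 3.3 (iii) p.28] -/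
@[simp] theorem isometricMorphisms_iff {A B : C} (φ : A ⟶ B) :
    isometricMorphisms F φ ↔ IsIsometry F φ := Iff.rfl

/-- Isometries contain the identities and are stable under composition
(`Div(ψ ≫ φ) = Base(ψ)^* Div(φ) · Div(ψ)^{deg_Fr φ}`, [FrdI] Rem. 1.1.1), so that "the subcategory
determined by the isometries" is a (wide) subcategory. [cite: MochizukiFrdII2008, Ex 3.3 (iii) p.28] -/
instance isometricMorphisms_isMultiplicative : (isometricMorphisms F).IsMultiplicative where
  id_mem X := div_id F X
  comp_mem ψ φ hψ hφ := by
    change Div F (ψ ≫ φ) = 1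
    rw [div_comp, show Div F φ = 1 from hφ, show Div F ψ = 1 from hψ, map_one, one_pow, mul_one]

/-- Linear morphisms (`deg_Fr = 1`) contain the identities and are stable under composition, so
that `C^lin` ([FrdI] Def. 1.2 (iv)) is a (wide) subcategory. [cite: MochizukiFrdII2008, Ex 3.3 (iii) p.29] -/
instance linearMorphisms_isMultiplicative : (linearMorphisms F).IsMultiplicative where
  id_mem X := degFr_id F X
  comp_mem ψ φ hψ hφ := by
    change degFr F (ψ ≫ φ) = 1
    rw [degFr_comp, show degFr F φ = 1 from hφ, show degFr F ψ = 1 from hψ, mul_one]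

/-- The values of the zero monoid `0_D` (t2's `zeroMonoid D`, `ModelFrobenioidFunctor.lean`; [FrdI]
Prop. 4.4 (i)) have one element — local copy of the instance of `DivisorialDescriptions.lean` to keep the
import light (distinct name; same content as `PreFrobenioid.subsingleton_zeroMonoid_obj` there).
[cite: MochizukiFrdII2008, Ex 3.3 (iii) p.29] -/
instance subsingleton_zeroMonoid_obj_arch (X : Dᵒᵖ) :
    Subsingleton ((zeroMonoid D : Dᵒᵖ ⥤ CommMonCat.{0}).obj X) :=
  inferInstanceAs (Subsingleton PUnit)

/-- The pre-Frobenioid structure, over the ZERO divisor monoid, on "the subcategory determined by the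
isometries" of a pre-Frobenioid `C → F_Φ`: `(Base, 0, deg_Fr)` ([FrdII] Ex. 3.3 (iii): "`A` is a
Frobenioid over the base category `D`, which is, in fact, of group-like type").
[cite: MochizukiFrdII2008, Ex 3.3 (iii) p.29] -/
def isometriesToElem :
    WideSubcategory (isometricMorphisms F) ⥤ ElemFrobenioid (zeroMonoid D : Dᵒᵖ ⥤ CommMonCat.{0}) where
  obj X := ElemFrobenioid.of (zeroMonoid D : Dᵒᵖ ⥤ CommMonCat.{0}) (baseObj F X.obj)
  map f := ElemFrobenioid.homMk (Base F f.1) 1 (degFr F f.1)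
  map_id X := ElemFrobenioid.Hom.ext (base_id F X.obj) rfl (degFr_id F X.obj)
  map_comp f g := ElemFrobenioid.Hom.ext (base_comp F f.1 g.1) (Subsingleton.elim _ _)
    (degFr_comp F f.1 g.1)

/-- `Base` of the isometry structure is `Base` of the ambient pre-Frobenioid.
[cite: MochizukiFrdII2008, Ex 3.3 (iii) p.29] -/
@[simp] theorem isometriesToElem_base {X Y : WideSubcategory (isometricMorphisms F)} (f : X ⟶ Y) :
    Base (isometriesToElem F) f = Base F f.1 := rfl

/-- `deg_Fr` of the isometry structure is `deg_Fr` of the ambient pre-Frobenioid.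
[cite: MochizukiFrdII2008, Ex 3.3 (iii) p.29] -/
@[simp] theorem isometriesToElem_degFr {X Y : WideSubcategory (isometricMorphisms F)} (f : X ⟶ Y) :
    degFr (isometriesToElem F) f = degFr F f.1 := rfl

/-- Every object is group-like for the isometry structure (`Φ = 0`): "of group-like type".
[cite: MochizukiFrdII2008, Ex 3.3 (iii) p.29] -/
theorem isGroupLikeObj_isometriesToElem (X : WideSubcategory (isometricMorphisms F)) :
    IsGroupLikeObj (isometriesToElem F) X := fun x => Subsingleton.elim x 1

end PreFrobenioid

namespace ArchFrd

/-! ### Example 3.3 (iii): `A₀ ⊆ C₀`, the isometries -/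

/-- `A₀ ⊆ C₀`, "the respective subcategories determined by the isometries" (FrdII Ex. 3.3 (iii),
p. 28): the wide subcategory of `C₀` on the arrows with `Div = 0`.
[cite: MochizukiFrdII2008, Ex 3.3 (iii) p.28] -/
abbrev A0 : Type := WideSubcategory (PreFrobenioid.isometricMorphisms C0.toElem)

namespace A0

/-- The inclusion `A₀ ⊆ C₀`. [cite: MochizukiFrdII2008, Ex 3.3 (iii) p.28] -/
abbrev ι : A0 ⥤ C0 := wideSubcategoryInclusion _

/-- The pre-Frobenioid structure `A₀ → F_0` over the base category `D₀` with the ZERO divisor monoid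
(FrdII Ex. 3.3 (iii), p. 29: "`A` is a Frobenioid over the base category `D`, which is, in fact, of
group-like type"): `(Base, 0, deg_Fr)`. [cite: MochizukiFrdII2008, Ex 3.3 (iii) p.29] -/
abbrev toElem : A0 ⥤ ElemFrobenioid (zeroMonoid D0 : D0ᵒᵖ ⥤ CommMonCat.{0}) :=
  PreFrobenioid.isometriesToElem C0.toElem

/-- "of group-like type" for `A₀` — PROVED (the divisor monoid is `0`).
[cite: MochizukiFrdII2008, Ex 3.3 (iii) p.29] -/
theorem isOfType_isGroupLikeObj : PreFrobenioid.IsOfType (PreFrobenioid.IsGroupLikeObj toElem) :=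
  PreFrobenioid.isGroupLikeObj_isometriesToElem C0.toElem

/-- An arrow of `C₀` is an isometry iff its ratio `tip_K / (|c| · tip_L^d)` is `1`.
[cite: MochizukiFrdII2008, Ex 3.3 (iii) p.28] -/
theorem isIsometry_iff_ratio_eq_one {X Y : C0} (φ : X ⟶ Y) :
    PreFrobenioid.IsIsometry C0.toElem φ ↔ C0.ratio φ = 1 := by
  change C0.div φ = 1 ↔ _
  constructor
  · intro h
    have h' : Real.log (C0.ratio φ) = 0 := by
      rw [← C0.coe_toAdd_div, h]; rfl
    rcases Real.log_eq_zero.mp h' with h0 | h1 | hm1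
    · exact absurd h0 (C0.ratio_pos φ).ne'
    · exact h1
    · linarith [C0.ratio_pos φ]
  · intro h
    apply Multiplicative.toAdd.injective
    apply NNReal.eq
    rw [C0.coe_toAdd_div, h, Real.log_one]
    rfl

/-- An arrow of `C₀` is an isometry iff `|c| · tip(A_L)^d = tip(A_K)`, i.e. the isomorphism (c) maps
the boundary of `A_L^{⊗d}` into the boundary of `A_K|_L`. [cite: MochizukiFrdII2008, Ex 3.3 (iii) p.28] -/
theorem isIsometry_iff_norm_mul_tip_pow {X Y : C0} (φ : X ⟶ Y) :
    PreFrobenioid.IsIsometry C0.toElem φ ↔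
      ‖(C0.scalar φ : ℂ)‖ * X.tip ^ (C0.degFr φ : ℕ) = Y.tip := by
  rw [isIsometry_iff_ratio_eq_one]
  have hpos : 0 < ‖(C0.scalar φ : ℂ)‖ * X.tip ^ (C0.degFr φ : ℕ) :=
    mul_pos (norm_pos_iff.mpr (C0.scalar φ).ne_zero) (pow_pos X.tip_pos _)
  unfold C0.ratio
  rw [div_eq_one_iff_eq hpos.ne']
  exact eq_comm

end A0

/-! ### Example 3.3 (iii): `N₀ := A₀^lin`, the non-rigidified angloid -/

/-- `N₀ := A₀^lin ⊆ A₀`, "the respective subcategories determined by the linear morphisms — cf.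
[Mzk5], Definition 1.2, (iv)" (FrdII Ex. 3.3 (iii), p. 29): the absolute *non-rigidified angloid*.
[cite: MochizukiFrdII2008, Ex 3.3 (iii) p.29] -/
abbrev N0 : Type := WideSubcategory (PreFrobenioid.linearMorphisms A0.toElem)

namespace N0

/-- The inclusion `N₀ ⊆ A₀`. [cite: MochizukiFrdII2008, Ex 3.3 (iii) p.29] -/
abbrev ι : N0 ⥤ A0 := wideSubcategoryInclusion _

/-- The composite inclusion `N₀ → C₀` ("the natural functor `N → C`", FrdII Ex. 3.3 (iv), p. 29).
[cite: MochizukiFrdII2008, Ex 3.3 (iv) p.29] -/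
abbrev toC0 : N0 ⥤ C0 := ι ⋙ A0.ι

/-- The underlying `C₀`-object of an object of `N₀`. [cite: MochizukiFrdII2008, Ex 3.3 (iii) p.29] -/
abbrev carrier (X : N0) : C0 := X.obj.obj

/-- A *real* object of `N₀` (an object of `N₀[ℝ]`, FrdII Def. 3.1 (v) / Ex. 3.3 (iv)).
[cite: MochizukiFrdII2008, Ex 3.3 (iv) p.29] -/
def IsRealObj (X : N0) : Prop := X.carrier.IsRealObj

/-- The real object of tip `1`, the `A ∈ Ob(N₀[ℝ])` at which the slice `R₀ := (N₀)_A` is taken.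
[cite: MochizukiFrdII2008, Ex 3.3 (iv) p.29] -/
def realUnit : N0 := ⟨⟨C0.realOfTip 1⟩⟩

/-- `realUnit` is real. [cite: MochizukiFrdII2008, Ex 3.3 (iv) p.29] -/
theorem isRealObj_realUnit : realUnit.IsRealObj := rfl

/-- Constructor for arrows of `N₀` from an arrow of `C₀` that is a linear isometry.
[cite: MochizukiFrdII2008, Ex 3.3 (iii) p.29] -/
def homMk {X Y : N0} (φ : X.carrier ⟶ Y.carrier) (hiso : PreFrobenioid.IsIsometry C0.toElem φ)
    (hlin : C0.degFr φ = 1) : X ⟶ Y :=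
  ⟨⟨φ, hiso⟩, hlin⟩

/-- The underlying `C₀`-arrow of an arrow of `N₀`. [cite: MochizukiFrdII2008, Ex 3.3 (iii) p.29] -/
abbrev homCarrier {X Y : N0} (f : X ⟶ Y) : X.carrier ⟶ Y.carrier := f.1.1

/-- The underlying arrow of `homMk`. [cite: MochizukiFrdII2008, Ex 3.3 (iii) p.29] -/
@[simp] theorem homCarrier_homMk {X Y : N0} (φ : X.carrier ⟶ Y.carrier)
    (hiso : PreFrobenioid.IsIsometry C0.toElem φ) (hlin : C0.degFr φ = 1) :
    homCarrier (homMk φ hiso hlin) = φ := rfl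

/-- Two arrows of `N₀` are equal iff their underlying `C₀`-arrows are.
[cite: MochizukiFrdII2008, Ex 3.3 (iii) p.29] -/
theorem hom_ext {X Y : N0} {f g : X ⟶ Y} (h : homCarrier f = homCarrier g) : f = g := by
  obtain ⟨⟨f, hf⟩, hf'⟩ := f
  obtain ⟨⟨g, hg⟩, hg'⟩ := g
  obtain rfl : f = g := h
  rfl

/-- The underlying arrow of an identity. [cite: MochizukiFrdII2008, Ex 3.3 (iii) p.29] -/
@[simp] theorem homCarrier_id (X : N0) : homCarrier (𝟙 X) = 𝟙 X.carrier := rfl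

/-- The underlying arrow of a composite. [cite: MochizukiFrdII2008, Ex 3.3 (iii) p.29] -/
@[simp] theorem homCarrier_comp {X Y Z : N0} (f : X ⟶ Y) (g : Y ⟶ Z) :
    homCarrier (f ≫ g) = homCarrier f ≫ homCarrier g := rfl

/-- The real scalar `t_Y / t_X ∈ ℝ_{>0} ⊆ ℂ^×` rescaling a real object of tip `t_X` onto one of tip
`t_Y`. [cite: MochizukiFrdII2008, Ex 3.3 (iv) p.29] -/
def rescale (X Y : C0) : ℂˣ := ofPosReal ℂ ⟨Y.tip / X.tip, div_pos Y.tip_pos X.tip_pos⟩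

/-- The norm of the rescaling scalar. [cite: MochizukiFrdII2008, Ex 3.3 (iv) p.29] -/
theorem norm_rescale (X Y : C0) : ‖(rescale X Y : ℂ)‖ = Y.tip / X.tip := by
  rw [rescale, coe_ofPosReal, RCLike.norm_ofReal, abs_of_pos (div_pos Y.tip_pos X.tip_pos)]

/-- The rescaling scalar is real. [cite: MochizukiFrdII2008, Ex 3.3 (iv) p.29] -/
theorem rescale_mem_scalars (X Y : C0) (K : D0) : rescale X Y ∈ D0.scalars K :=
  ofPosReal_mem_scalars _ K

/-- Rescaling an isotropic region of tip `t_X` by `t_Y / t_X` lands in the isotropic region of tip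
`t_Y`. [cite: MochizukiFrdII2008, Ex 3.3 (iv) p.29] -/
theorem rescale_smul_subset {X Y : C0} (hX : X.IsNaivelyIsotropic) (hY : Y.IsNaivelyIsotropic) :
    rescale X Y • X.region.carrier ^ ((1 : ℕ+) : ℕ) ⊆ Y.region.carrier := by
  rw [PNat.one_coe, pow_one]
  rintro _ ⟨u, hu, rfl⟩
  rw [C0.mem_carrier_of_isIsotropic hX] at hu
  rw [C0.mem_carrier_of_isIsotropic hY, ← Subtype.coe_le_coe, coe_absHom]
  change ‖((rescale X Y * u : ℂˣ) : ℂ)‖ ≤ Y.tip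
  rw [Units.val_mul, norm_mul, norm_rescale]
  have hu' : ‖(u : ℂ)‖ ≤ X.tip := by rw [← coe_absHom]; exact hu
  calc Y.tip / X.tip * ‖(u : ℂ)‖ ≤ Y.tip / X.tip * X.tip := by
        gcongr; exact (div_pos Y.tip_pos X.tip_pos).le
    _ = Y.tip := div_mul_cancel₀ _ X.tip_pos.ne'

/-- The linear base-identity arrow of `C₀` rescaling a real object onto another real object.
[cite: MochizukiFrdII2008, Ex 3.3 (iv) p.29] -/
def realRescaleHom (X Y : C0) (hX : X.IsRealObj) (hY : Y.IsRealObj) : X ⟶ Y where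
  base := eqToHom (hX.trans hY.symm)
  degFr := 1
  scalar := rescale X Y
  scalar_mem := rescale_mem_scalars X Y X.base
  mapsTo := by
    have hXi := C0.isNaivelyIsotropic_of_isRealObj hX
    have hYi := C0.isNaivelyIsotropic_of_isRealObj hY
    refine (rescale_smul_subset hXi hYi).trans ?_
    rcases X with ⟨KX, AX, hAX⟩
    rcases Y with ⟨KY, AY, hAY⟩
    cases hX
    cases hY
    change AY.carrier ⊆ C0.pullRegion ⟨D0.real, AY, hAY⟩ (𝟙 D0.real)
    rw [C0.pullRegion_id]

/-- The rescaling arrow is an isometry (`|t_Y/t_X| · t_X = t_Y`). [cite: MochizukiFrdII2008, Ex 3.3 (iv) p.29] -/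
theorem isIsometry_realRescaleHom (X Y : C0) (hX : X.IsRealObj) (hY : Y.IsRealObj) :
    PreFrobenioid.IsIsometry C0.toElem (realRescaleHom X Y hX hY) := by
  rw [A0.isIsometry_iff_norm_mul_tip_pow]
  change ‖(rescale X Y : ℂ)‖ * X.tip ^ ((1 : ℕ+) : ℕ) = Y.tip
  rw [norm_rescale, PNat.one_coe, pow_one, div_mul_cancel₀ _ X.tip_pos.ne']

/-- The rescaling arrow of `N₀` between two real objects. [cite: MochizukiFrdII2008, Ex 3.3 (iv) p.29] -/
def realRescale (X Y : N0) (hX : X.IsRealObj) (hY : Y.IsRealObj) : X ⟶ Y :=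
  homMk (realRescaleHom X.carrier Y.carrier hX hY)
    (isIsometry_realRescaleHom X.carrier Y.carrier hX hY) rfl

/-- The two rescalings compose to the identity. [cite: MochizukiFrdII2008, Ex 3.3 (iv) p.29] -/
theorem realRescale_comp (X Y : N0) (hX : X.IsRealObj) (hY : Y.IsRealObj) :
    realRescale X Y hX hY ≫ realRescale Y X hY hX = 𝟙 X := by
  apply hom_ext
  rw [homCarrier_comp, homCarrier_id]
  haveI : Subsingleton (X.carrier.base ⟶ X.carrier.base) := by
    rw [show X.carrier.base = D0.real from hX]; infer_instance
  refine C0.hom_ext (Subsingleton.elim _ _) rfl ?_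
  change (C0.Base (realRescaleHom X.carrier Y.carrier hX hY)).act (rescale Y.carrier X.carrier) *
      rescale X.carrier Y.carrier ^ ((1 : ℕ+) : ℕ) = 1
  rw [D0.galAct_eq_self_of_mem_scalars_real _ (rescale_mem_scalars _ _ D0.real), PNat.one_coe,
    pow_one]
  ext : 1
  rw [Units.val_mul, rescale, rescale, coe_ofPosReal, coe_ofPosReal, Units.val_one, ← RCLike.ofReal_mul]
  change (((X.carrier.tip / Y.carrier.tip) * (Y.carrier.tip / X.carrier.tip) : ℝ) : ℂ) = 1
  rw [div_mul_div_comm, mul_comm Y.carrier.tip X.carrier.tip,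
    div_self (mul_pos X.carrier.tip_pos Y.carrier.tip_pos).ne']
  simp

/-- **Example 3.3 (iv)**: "Observe that all real objects of `N₀` are isomorphic" — PROVED (rescale by
the positive real `t_Y / t_X`). [cite: MochizukiFrdII2008, Ex 3.3 (iv) p.29] -/
theorem nonempty_iso_of_isRealObj (X Y : N0) (hX : X.IsRealObj) (hY : Y.IsRealObj) :
    Nonempty (X ≅ Y) :=
  ⟨{ hom := realRescale X Y hX hY
     inv := realRescale Y X hY hX
     hom_inv_id := realRescale_comp X Y hX hY
     inv_hom_id := realRescale_comp Y X hY hX }⟩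

end N0

/-! ### Example 3.3 (iv): `R₀ := (N₀)_A`, the rigidified angloid -/

/-- `R₀ := (N₀)_A` for `A ∈ Ob(N₀[ℝ])` (FrdII Ex. 3.3 (iv), p. 29): the slice of the non-rigidified
angloid over the real object of tip `1` — the absolute *rigidified angloid* ("it makes sense to
define" it, all real objects being isomorphic: `N0.nonempty_iso_of_isRealObj`).
[cite: MochizukiFrdII2008, Ex 3.3 (iv) p.29] -/
abbrev R0 : Type := Over N0.realUnit

namespace R0

/-- The forgetful functor `R₀ = (N₀)_A → N₀` (`(j_A)_!`, [FrdI] §0). [cite: MochizukiFrdII2008, Ex 3.3 (iv) p.29] -/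
abbrev toN0 : R0 ⥤ N0 := Over.forget _

/-- "the natural functor `R → C`" in the absolute case: `R₀ → N₀ → A₀ → C₀` (FrdII Ex. 3.3 (iv), p. 29).
[cite: MochizukiFrdII2008, Ex 3.3 (iv) p.29] -/
abbrev toC0 : R0 ⥤ C0 := toN0 ⋙ N0.toC0

/-- The projection `R₀ → D₀`. [cite: MochizukiFrdII2008, Ex 3.3 (iv) p.29] -/
abbrev toD0 : R0 ⥤ D0 := toC0 ⋙ C0.baseFunctor

end R0

/-- The projection `N₀ → D₀`. [cite: MochizukiFrdII2008, Ex 3.3 (iii) p.29] -/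
abbrev N0.toD0 : N0 ⥤ D0 := N0.toC0 ⋙ C0.baseFunctor

/-- The projection `A₀ → D₀`. [cite: MochizukiFrdII2008, Ex 3.3 (iii) p.28] -/
abbrev A0.toD0 : A0 ⥤ D0 := A0.ι ⋙ C0.baseFunctor

end ArchFrd

end

end Literature.AlgebraicGeometry.Frobenioids
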